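import Summits.KontsevichZagierPeriods.KontsevichZagierPeriods.Theorems.FermatIsogenyBetaProductSectorStubDdStepRight
import Summits.KontsevichZagierPeriods.KontsevichZagierPeriods.Theorems.FermatIsogenyBetaProductSectorDefs
import Literature.NumberTheory.Transcendental.SemialgebraicVolume

/-!
# `BetaProductSector` (stmt-KontsevichZagierPeriods-3898), line `registered` (v3) — stub `stub_ddStep`,
# part 6: the right chain (branch exchange) and the two-duplication move DD

THE REFLECTION-FREE TWO-DUPLICATION MOVE "DD" of the line (Legendre's duplication `Γ(2x)√π = 2^{2x-1}Γ(x)Γ(x+½)`,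
Andrews–Askey–Roy 1999 Thm 1.5.1, applied at `c+d` against its application at `c`):

  `B(c+½-d, 2c+2d) · B(c, d) = 4^d · B(2c, c+d+½) · B(c+½-d, d)`     (`0 < c`, `0 < d < c + ½`),

realised INSIDE the Kontsevich–Zagier calculus of moves (Kontsevich–Zagier 2001 §1.2, rules (1), (2) only) between
the pinned representations `r = [(0,1)², κ x^{c-½-d}(1-x)^{2c+2d-1} y^{c-1}(1-y)^{d-1}]` and
`r' = [(0,1)², κ4^d x^{2c-1}(1-x)^{c+d-½} y^{c-½-d}(1-y)^{d-1}]`, uniformly in a real-algebraic weight `κ` and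
WITHOUT cancellation. Both boxes are carried onto the common parameter surface
`P = {(w,v) | 0 < w, w(1+w) < v(1-v)}` — the pairs `(-w, v)` (negative root, root in `(0,1)`) of the quartics
`X²(1-X)² = F·X + F·G/4`:

* the LEFT chain (part 4, `DdStep.left_chain`): Kummer covering `y = η²`, swap + linear Dirichlet chart onto the
  simplex, `χ(x,σ) = (σ,xσ)` onto the lens `{0 < g < σ(1-σ)}`, the chart of the lens by `P`; result
  `[P, ℓ]`, `ℓ = 4 F^{c-½-d} X^{d-1} D(v+w)` (`F = (1+w-v)(v(1-v)-w(1+w))`, `X = 4wv((1-v)²+w(2+w-v))`,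
  `D = w²+2w+(1-v)²`);
* the RIGHT chain (this file, `DdStep.right_chain`, the BRANCH EXCHANGE): `D(v+w) = v·N_R + w·N_E` with
  `N_R = -∂F/∂w`, `N_E = ∂F/∂v` splits `ℓ = H + G`; the ghost term `G = 4F^{c-½-d}X^{d-1}·wN_E` changes sign across
  the critical curve `N_E = 0` of the fibre cubic, and the ghost chart `(w,v) ↦ (w,F)` (part 3) carries `[P₊, G]`
  and `[P₋, -G]` onto ONE representation on the common image of the two laps, so the ghost terms cancel (rules
  (1a), (1b), (2)); the positive part `[P, H]` is carried by `(w,v) ↦ (v,F)` (part 2) onto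
  `M = {0<v<1, 0<φ<v(1-v)²}` and met there by the right box along `ρ(x,y) = (1-x, yx²(1-x))` (part 1);
* scaling by `κ` (`KZ.Equivalent.constMul`) and pinning (rule (1)) as in the landed QUAD move.

All intermediate representations are constructed (Euler–Mellin integrands; the image of a lap is semialgebraic by
the tree's Tarski–Seidenberg image theorem, the critical curve is null by the tree's polynomial zero-set lemma).
Everything is proved; no `def`, no named fact.

References: Kontsevich–Zagier 2001 §1.2; Andrews–Askey–Roy 1999 Thm 1.5.1.
-/

noncomputable section

open MeasureTheory Set
open Literature.ModelTheory.ExponentialFields (IsSemialgebraic)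
open MvPolynomial (aeval X C)

namespace Summit.KontsevichZagierPeriods.FermatIsogeny.BetaProductSectorStubs

open Literature.NumberTheory.Transcendental
open Literature.NumberTheory.Transcendental.KZ

namespace DdStep

/-! ## The right chain -/

/-- **The right chain of the two-duplication move** (branch exchange): a representation `L` pinned on the
parameter surface `P` with the left integrand `ℓ = 4 F^{c-½-d} X^{d-1} D(v+w)` is equivalent to a representation
pinned on the open box with the weighted right integrand `4^d x^{2c-1}(1-x)^{c+d-½} y^{c-½-d}(1-y)^{d-1}`, WHICH
EXISTS (Euler's Beta integral): discard the null curve `N_E = 0` and split `P` into its two laps (rule 1a), split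
`ℓ = H + G` resp. `H = ℓ + (-G)` on the laps (rule 1b), cancel the two ghost terms through the ghost chart
`(w,v) ↦ (w,F)` onto their common image (rule 2 twice), reassemble `[P, H]` (rule 1a), and carry it through the
chart `(w,v) ↦ (v,F)` onto `M` and back along `ρ(x,y) = (1-x, yx²(1-x))` onto the box (rule 2 twice).
[cite: KontsevichZagier2001, §1.2 rule (2)] -/
theorem right_chain : ∀ (c d : ℚ), 0 < c → 0 < d → d < c + 1 / 2 → ∀ (L : Literature.NumberTheory.Transcendental.KZ.IntegralRep 2), L.domain = {z : Fin 2 → ℝ | 0 < z 0 ∧ z 0 * (1 + z 0) < z 1 * (1 - z 1)} → Set.EqOn L.integrand (Literature.NumberTheory.Transcendental.KZ.mellinIntegrand (![(1 + MvPolynomial.X 0 - MvPolynomial.X 1) * (MvPolynomial.X 1 * (1 - MvPolynomial.X 1) - MvPolynomial.X 0 * (1 + MvPolynomial.X 0)), 4 * MvPolynomial.X 0 * MvPolynomial.X 1 * ((1 - MvPolynomial.X 1) ^ 2 + MvPolynomial.X 0 * (2 + MvPolynomial.X 0 - MvPolynomial.X 1)), (MvPolynomial.X 0 ^ 2 + 2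 * MvPolynomial.X 0 + (1 - MvPolynomial.X 1) ^ 2) * (MvPolynomial.X 1 + MvPolynomial.X 0)] : Fin 3 → MvPolynomial (Fin 2) ℚ) ![c - 1 / 2 - d, d - 1, 1] 4) L.domain → ∃ R : Literature.NumberTheory.Transcendental.KZ.IntegralRep 2, R.domain = {x | ∀ i, x i ∈ Set.Ioo (0:ℝ) 1} ∧ Set.EqOn R.integrand (fun z => (4:ℝ) ^ (d:ℝ) * (z 0) ^ (2 * (c:ℝ) - 1) * (1 - z 0) ^ ((c:ℝ) + d + 1 / 2 - 1) * (z 1) ^ ((c:ℝ) + 1 / 2 - d - 1) * (1 - z 1) ^ ((d:ℝ) - 1)) R.domain ∧ Literature.NumberTheory.Transcendental.KZ.Equivalent L R := by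
  intro c d hc hd hdc L hLd hLi
  have hbox : ({z : Fin 2 → ℝ | z 0 ∈ Set.Ioo (0:ℝ) 1 ∧ z 1 ∈ Set.Ioo (0:ℝ) 1}) =
      {x | ∀ i, x i ∈ Set.Ioo (0:ℝ) 1} := Set.ext fun z => by simp only [mem_setOf_eq, Fin.forall_fin_two]
  -- (0) the weighted right box `R`, which exists (Euler's Beta integral)
  have hintR : IntegrableOn (KZ.mellinIntegrand (![X 0, 1 - X 0, X 1, 4 - 4 * X 1] : Fin 4 → MvPolynomial (Fin 2) ℚ)
      ![2 * c - 1, c + d + 1 / 2 - 1, c + 1 / 2 - d - 1, d - 1] 4)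
      {z : Fin 2 → ℝ | z 0 ∈ Set.Ioo (0:ℝ) 1 ∧ z 1 ∈ Set.Ioo (0:ℝ) 1} := by
    rw [hbox]
    have h2c : (0:ℚ) < 2 * c := by positivity
    have hA : (0:ℚ) < c + 1 / 2 - d := by linarith
    have hE : (0:ℚ) < c + d + 1 / 2 := by positivity
    have h := (KZ.integrableOn_cubeBetaIntegrand ![2 * c, c + 1 / 2 - d] ![c + d + 1 / 2, d]
      (Fin.forall_fin_two.2 ⟨⟨h2c, hE⟩, ⟨hA, hd⟩⟩)).const_mul ((4:ℝ) ^ (d:ℝ))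
    refine IntegrableOn.congr_fun h (fun z hz => ?_) (KZ.measurableSet_setOf_forall_apply_mem_Ioo 2)
    rw [mellin_R_apply]
    simp only [Fin.prod_univ_two, Matrix.cons_val_zero, Matrix.cons_val_one]
    push_cast
    linear_combination (-((z 0) ^ (2 * (c:ℝ) - 1) * (1 - z 0) ^ ((c:ℝ) + d + 1 / 2 - 1) *
      (z 1) ^ ((c:ℝ) + 1 / 2 - d - 1))) * four_mul_rpow_key (d:ℝ) (hz 1).2
  have hposR : ∀ z ∈ {z : Fin 2 → ℝ | z 0 ∈ Set.Ioo (0:ℝ) 1 ∧ z 1 ∈ Set.Ioo (0:ℝ) 1}, ∀ k, 0 < aeval z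
      ((![X 0, 1 - X 0, X 1, 4 - 4 * X 1] : Fin 4 → MvPolynomial (Fin 2) ℚ) k) := by
    rintro z ⟨h0, h1⟩ k
    fin_cases k
    · simpa using h0.1
    · simpa [sub_pos] using h0.2
    · simpa using h1.1
    · simp only [Fin.reduceFinMk, Matrix.cons_val, map_sub, map_mul, map_ofNat, MvPolynomial.aeval_X, sub_pos]
      linarith [h1.2]
  let R : KZ.IntegralRep 2 := ⟨{z : Fin 2 → ℝ | z 0 ∈ Set.Ioo (0:ℝ) 1 ∧ z 1 ∈ Set.Ioo (0:ℝ) 1}, _,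
    KZ.isSemialgebraic_box2, KZ.isSemialgebraicFunOn_mellinIntegrand KZ.isSemialgebraic_box2 _ _ 4 hposR, hintR⟩
  -- (1) the chart `ρ` of `M` by the box: the representation on `M`, which exists
  obtain ⟨ρ, ρ', hρ0, hρ1, hsaρ, hderivρ, hinjρ, himageρ, hdetρ⟩ := exists_chartRho
  have hpullρ : ∀ z ∈ {z : Fin 2 → ℝ | z 0 ∈ Set.Ioo (0:ℝ) 1 ∧ z 1 ∈ Set.Ioo (0:ℝ) 1},
      R.integrand z = KZ.mellinIntegrand (![X 1, 4 * X 0 * (X 0 * (1 - X 0) ^ 2 - X 1), X 0] :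
        Fin 3 → MvPolynomial (Fin 2) ℚ) ![c - 1 / 2 - d, d - 1, 1] 4 (ρ z) * |(ρ' z).det| := by
    intro z hz
    rw [hdetρ z hz]
    change KZ.mellinIntegrand _ _ _ z = _
    rw [mellin_R_apply, mellin_M_apply, hρ0, hρ1]
    exact (right_pullback_rho _ _ hz.1.1 hz.1.2 hz.2.1 hz.2.2).symm
  have hposM : ∀ y ∈ {z : Fin 2 → ℝ | 0 < z 0 ∧ z 0 < 1 ∧ 0 < z 1 ∧ z 1 < z 0 * (1 - z 0) ^ 2}, ∀ k, 0 < aeval y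
      ((![X 1, 4 * X 0 * (X 0 * (1 - X 0) ^ 2 - X 1), X 0] : Fin 3 → MvPolynomial (Fin 2) ℚ) k) := by
    rintro y ⟨h0, h0', h1, h2⟩ k
    fin_cases k
    · simpa using h1
    · simp only [Fin.reduceFinMk, Matrix.cons_val_one, Matrix.cons_val_zero, map_sub, map_mul, map_pow, map_one,
        map_ofNat, MvPolynomial.aeval_X]
      have : 0 < y 0 * (1 - y 0) ^ 2 - y 1 := sub_pos.2 h2
      positivity
    · simpa using h0
  have hintM : IntegrableOn (KZ.mellinIntegrand (![X 1, 4 * X 0 * (X 0 * (1 - X 0) ^ 2 - X 1), X 0] :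
      Fin 3 → MvPolynomial (Fin 2) ℚ) ![c - 1 / 2 - d, d - 1, 1] 4)
      {z : Fin 2 → ℝ | 0 < z 0 ∧ z 0 < 1 ∧ 0 < z 1 ∧ z 1 < z 0 * (1 - z 0) ^ 2} := by
    rw [← himageρ, integrableOn_image_iff_integrableOn_abs_det_fderiv_smul volume KZ.measurableSet_box2
      (fun z _ => (hderivρ z).hasFDerivWithinAt) hinjρ]
    refine R.integrableOn.congr_fun (fun z hz => ?_) KZ.measurableSet_box2
    rw [hpullρ z hz, smul_eq_mul, mul_comm]
  let Mr : KZ.IntegralRep 2 := ⟨{z : Fin 2 → ℝ | 0 < z 0 ∧ z 0 < 1 ∧ 0 < z 1 ∧ z 1 < z 0 * (1 - z 0) ^ 2}, _,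
    isSemialgebraic_regionM, KZ.isSemialgebraicFunOn_mellinIntegrand isSemialgebraic_regionM _ _ 4 hposM, hintM⟩
  have relρ : of R - of Mr ∈ relations :=
    changeOfVariablesRel_subset_relations ⟨2, R, Mr, ρ, ρ', hsaρ, fun z _ => (hderivρ z).hasFDerivWithinAt,
      hinjρ, himageρ.symm, fun z hz => hpullρ z hz, rfl⟩
  -- (2) the chart `(w,v) ↦ (v,F)` of `M` by `P`: the positive part `[P, H]`, which exists
  obtain ⟨Φ, Φ', hΦ0, hΦ1, hsaΦ, hderivΦ, hinjΦ, himageΦ, hdetΦ⟩ := exists_chartPM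
  have hpullΦ : ∀ z ∈ {z : Fin 2 → ℝ | 0 < z 0 ∧ z 0 * (1 + z 0) < z 1 * (1 - z 1)},
      KZ.mellinIntegrand (![(1 + X 0 - X 1) * (X 1 * (1 - X 1) - X 0 * (1 + X 0)),
          4 * X 0 * X 1 * ((1 - X 1) ^ 2 + X 0 * (2 + X 0 - X 1)),
          X 1 * (3 * X 0 ^ 2 + 2 * (2 - X 1) * X 0 + (1 - X 1) ^ 2)] : Fin 3 → MvPolynomial (Fin 2) ℚ)
        ![c - 1 / 2 - d, d - 1, 1] 4 z = Mr.integrand (Φ z) * |(Φ' z).det| := by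
    intro z hz
    rw [hdetΦ z hz, mellin_H_apply]
    change _ = KZ.mellinIntegrand _ _ _ (Φ z) * _
    rw [mellin_M_apply, hΦ0, hΦ1]
    exact (right_pullback_PM _ _ (z 0) (z 1)).symm
  have hposH : ∀ z ∈ {z : Fin 2 → ℝ | 0 < z 0 ∧ z 0 * (1 + z 0) < z 1 * (1 - z 1)}, ∀ k, 0 < aeval z
      ((![(1 + X 0 - X 1) * (X 1 * (1 - X 1) - X 0 * (1 + X 0)),
          4 * X 0 * X 1 * ((1 - X 1) ^ 2 + X 0 * (2 + X 0 - X 1)),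
          X 1 * (3 * X 0 ^ 2 + 2 * (2 - X 1) * X 0 + (1 - X 1) ^ 2)] : Fin 3 → MvPolynomial (Fin 2) ℚ) k) := by
    intro z hz k
    obtain ⟨hz1, hz1', hwv⟩ := regionP_bounds hz
    have hw := hz.1
    have h1 : 0 < 1 - z 1 := sub_pos.2 hz1'
    fin_cases k
    · simpa using mul_pos (by linarith : 0 < 1 + z 0 - z 1) (sub_pos.2 hz.2)
    · simp only [Fin.reduceFinMk, Matrix.cons_val_one, Matrix.cons_val_zero, map_sub, map_mul, map_add, map_pow,
        map_one, map_ofNat, MvPolynomial.aeval_X]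
      have : 0 < (1 - z 1) ^ 2 + z 0 * (2 + z 0 - z 1) := by nlinarith [pow_pos h1 2]
      positivity
    · simp only [Fin.reduceFinMk, Matrix.cons_val, map_sub, map_mul, map_add, map_pow, map_one, map_ofNat,
        MvPolynomial.aeval_X]
      have : 0 < 3 * z 0 ^ 2 + 2 * (2 - z 1) * z 0 + (1 - z 1) ^ 2 := by
        nlinarith [pow_pos h1 2, sq_nonneg (z 0), mul_pos hw h1]
      positivity
  have hintH : IntegrableOn (KZ.mellinIntegrand (![(1 + X 0 - X 1) * (X 1 * (1 - X 1) - X 0 * (1 + X 0)),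
      4 * X 0 * X 1 * ((1 - X 1) ^ 2 + X 0 * (2 + X 0 - X 1)),
      X 1 * (3 * X 0 ^ 2 + 2 * (2 - X 1) * X 0 + (1 - X 1) ^ 2)] : Fin 3 → MvPolynomial (Fin 2) ℚ)
        ![c - 1 / 2 - d, d - 1, 1] 4) {z : Fin 2 → ℝ | 0 < z 0 ∧ z 0 * (1 + z 0) < z 1 * (1 - z 1)} := by
    have key := (integrableOn_image_iff_integrableOn_abs_det_fderiv_smul volume
      isSemialgebraic_regionP.measurableSet_holds (fun z _ => (hderivΦ z).hasFDerivWithinAt) hinjΦ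
      Mr.integrand).1 (by rw [himageΦ]; exact Mr.integrableOn)
    refine key.congr_fun (fun z hz => ?_) isSemialgebraic_regionP.measurableSet_holds
    change |(Φ' z).det| • Mr.integrand (Φ z) = _
    rw [hpullΦ z hz, smul_eq_mul, mul_comm]
  let Hr : KZ.IntegralRep 2 := ⟨{z : Fin 2 → ℝ | 0 < z 0 ∧ z 0 * (1 + z 0) < z 1 * (1 - z 1)}, _,
    isSemialgebraic_regionP, KZ.isSemialgebraicFunOn_mellinIntegrand isSemialgebraic_regionP _ _ 4 hposH, hintH⟩
  have relΦ : of Hr - of Mr ∈ relations :=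
    changeOfVariablesRel_subset_relations ⟨2, Hr, Mr, Φ, Φ', hsaΦ, fun z _ => (hderivΦ z).hasFDerivWithinAt,
      hinjΦ, himageΦ.symm, fun z hz => hpullΦ z hz, rfl⟩
  -- (3) the two laps and the null curve `N_E = 0`
  set Pp : Set (Fin 2 → ℝ) := {z | (0 < z 0 ∧ z 0 * (1 + z 0) < z 1 * (1 - z 1)) ∧
    0 < 3 * z 1 ^ 2 - 2 * (2 + z 0) * z 1 + (1 + z 0) ^ 2} with hPp
  set Pm : Set (Fin 2 → ℝ) := {z | (0 < z 0 ∧ z 0 * (1 + z 0) < z 1 * (1 - z 1)) ∧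
    3 * z 1 ^ 2 - 2 * (2 + z 0) * z 1 + (1 + z 0) ^ 2 < 0} with hPm
  have hPps : IsSemialgebraic ℚ Pp := isSemialgebraic_lapPlus
  have hPms : IsSemialgebraic ℚ Pm := isSemialgebraic_lapMinus
  have hPpL : Pp ⊆ L.domain := fun z hz => by rw [hLd]; exact hz.1
  have hPmL : Pm ⊆ L.domain := fun z hz => by rw [hLd]; exact hz.1
  have hPpH : Pp ⊆ Hr.domain := fun z hz => hz.1
  have hPmH : Pm ⊆ Hr.domain := fun z hz => hz.1
  have hdisj : Pp ∩ Pm = ∅ := by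
    ext z
    simp only [hPp, hPm, mem_inter_iff, mem_setOf_eq, mem_empty_iff_false, iff_false]
    rintro ⟨⟨_, h1⟩, ⟨_, h2⟩⟩
    linarith
  have hnull : volume ({z : Fin 2 → ℝ | 0 < z 0 ∧ z 0 * (1 + z 0) < z 1 * (1 - z 1)} \ (Pp ∪ Pm)) = 0 := by
    refine measure_mono_null ?_ (volume_setOf_aeval_eq_zero
      (3 * X 1 ^ 2 - 2 * (2 + X 0) * X 1 + (1 + X 0) ^ 2 : MvPolynomial (Fin 2) ℚ) ?_)
    · rintro z ⟨hz, hzn⟩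
      simp only [hPp, hPm, mem_union, mem_setOf_eq, not_or] at hzn
      simp only [mem_setOf_eq, map_sub, map_mul, map_add, map_pow, map_one, map_ofNat, MvPolynomial.aeval_X]
      rcases lt_trichotomy (3 * z 1 ^ 2 - 2 * (2 + z 0) * z 1 + (1 + z 0) ^ 2) 0 with h | h | h
      · exact absurd ⟨hz, h⟩ hzn.2
      · exact h
      · exact absurd ⟨hz, h⟩ hzn.1
    · intro h0
      have h1 : aeval (fun _ : Fin 2 => (0:ℝ))
          (3 * X 1 ^ 2 - 2 * (2 + X 0) * X 1 + (1 + X 0) ^ 2 : MvPolynomial (Fin 2) ℚ) = 0 := by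
        rw [MvPolynomial.aeval_def, ← MvPolynomial.eval_map, h0, map_zero]
      simp only [map_sub, map_mul, map_add, map_pow, map_one, map_ofNat, MvPolynomial.aeval_X] at h1
      norm_num at h1
  -- (1a) discard the null curve and split `L` and `[P, H]` along the laps
  set L₁ : KZ.IntegralRep 2 := L.restrict (Pp ∪ Pm) (hPps.union hPms) (union_subset hPpL hPmL) with hL₁
  have rel₁ : of L - of L₁ ∈ relations :=
    L.of_sub_of_restrict_mem_relations _ (union_subset hPpL hPmL) (by rw [hLd]; exact hnull)
  set LP : KZ.IntegralRep 2 := L.restrict Pp hPps hPpL with hLP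
  set LM : KZ.IntegralRep 2 := L.restrict Pm hPms hPmL with hLM
  have rel₂ : of L₁ - of LP - of LM ∈ relations :=
    domainAddRel_subset_relations ⟨2, L₁, LP, LM, rfl,
      by rw [KZ.IntegralRep.domain_restrict, KZ.IntegralRep.domain_restrict, hdisj, measure_empty],
      fun _ _ => rfl, fun _ _ => rfl, rfl⟩
  set H₁ : KZ.IntegralRep 2 := Hr.restrict (Pp ∪ Pm) (hPps.union hPms) (union_subset hPpH hPmH) with hH₁
  have rel₃ : of Hr - of H₁ ∈ relations := Hr.of_sub_of_restrict_mem_relations _ (union_subset hPpH hPmH) hnull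
  set HP : KZ.IntegralRep 2 := Hr.restrict Pp hPps hPpH with hHP
  set HM : KZ.IntegralRep 2 := Hr.restrict Pm hPms hPmH with hHM
  have rel₄ : of H₁ - of HP - of HM ∈ relations :=
    domainAddRel_subset_relations ⟨2, H₁, HP, HM, rfl,
      by rw [KZ.IntegralRep.domain_restrict, KZ.IntegralRep.domain_restrict, hdisj, measure_empty],
      fun _ _ => rfl, fun _ _ => rfl, rfl⟩
  -- (1b) the ghost terms `[P₊, G]`, `[P₋, -G]`, which exist (`G = ℓ - H`)
  have hposGp : ∀ z ∈ Pp, ∀ k, 0 < aeval z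
      ((![(1 + X 0 - X 1) * (X 1 * (1 - X 1) - X 0 * (1 + X 0)),
          4 * X 0 * X 1 * ((1 - X 1) ^ 2 + X 0 * (2 + X 0 - X 1)),
          X 0 * (3 * X 1 ^ 2 - 2 * (2 + X 0) * X 1 + (1 + X 0) ^ 2)] : Fin 3 → MvPolynomial (Fin 2) ℚ) k) := by
    rintro z ⟨hz, hN⟩ k
    fin_cases k
    · simpa using hposH z hz 0
    · simpa using hposH z hz 1
    · simpa using mul_pos hz.1 hN
  have hposGm : ∀ z ∈ Pm, ∀ k, 0 < aeval z
      ((![(1 + X 0 - X 1) * (X 1 * (1 - X 1) - X 0 * (1 + X 0)),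
          4 * X 0 * X 1 * ((1 - X 1) ^ 2 + X 0 * (2 + X 0 - X 1)),
          X 0 * (-(3 * X 1 ^ 2 - 2 * (2 + X 0) * X 1 + (1 + X 0) ^ 2))] : Fin 3 → MvPolynomial (Fin 2) ℚ) k) := by
    rintro z ⟨hz, hN⟩ k
    fin_cases k
    · simpa using hposH z hz 0
    · simpa using hposH z hz 1
    · simpa using mul_pos hz.1 (neg_pos.2 hN)
  have hintGp : IntegrableOn (KZ.mellinIntegrand (![(1 + X 0 - X 1) * (X 1 * (1 - X 1) - X 0 * (1 + X 0)),
      4 * X 0 * X 1 * ((1 - X 1) ^ 2 + X 0 * (2 + X 0 - X 1)),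
      X 0 * (3 * X 1 ^ 2 - 2 * (2 + X 0) * X 1 + (1 + X 0) ^ 2)] : Fin 3 → MvPolynomial (Fin 2) ℚ)
        ![c - 1 / 2 - d, d - 1, 1] 4) Pp := by
    refine ((L.integrableOn.mono_set hPpL).sub (hintH.mono_set hPpH)).congr_fun (fun z hz => ?_)
      hPps.measurableSet_holds
    rw [Pi.sub_apply, hLi (hPpL hz), left_eq_H_add_Gp]
    ring
  have hintGm : IntegrableOn (KZ.mellinIntegrand (![(1 + X 0 - X 1) * (X 1 * (1 - X 1) - X 0 * (1 + X 0)),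
      4 * X 0 * X 1 * ((1 - X 1) ^ 2 + X 0 * (2 + X 0 - X 1)),
      X 0 * (-(3 * X 1 ^ 2 - 2 * (2 + X 0) * X 1 + (1 + X 0) ^ 2))] : Fin 3 → MvPolynomial (Fin 2) ℚ)
        ![c - 1 / 2 - d, d - 1, 1] 4) Pm := by
    refine ((hintH.mono_set hPmH).sub (L.integrableOn.mono_set hPmL)).congr_fun (fun z hz => ?_)
      hPms.measurableSet_holds
    rw [Pi.sub_apply, hLi (hPmL hz), H_eq_left_add_Gm]
    ring
  let Gp : KZ.IntegralRep 2 := ⟨Pp, _, hPps, KZ.isSemialgebraicFunOn_mellinIntegrand hPps _ _ 4 hposGp, hintGp⟩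
  let Gm : KZ.IntegralRep 2 := ⟨Pm, _, hPms, KZ.isSemialgebraicFunOn_mellinIntegrand hPms _ _ 4 hposGm, hintGm⟩
  have rel₅ : of LP - of HP - of Gp ∈ relations := by
    refine integrandAddRel_subset_relations ⟨2, LP, HP, Gp, rfl, rfl, fun z hz => ?_, rfl⟩
    change L.integrand z = KZ.mellinIntegrand _ _ _ z + KZ.mellinIntegrand _ _ _ z
    rw [hLi (hPpL hz)]
    exact left_eq_H_add_Gp c d z
  have rel₆ : of HM - of LM - of Gm ∈ relations := by
    refine integrandAddRel_subset_relations ⟨2, HM, LM, Gm, rfl, rfl, fun z hz => ?_, rfl⟩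
    change KZ.mellinIntegrand _ _ _ z = L.integrand z + KZ.mellinIntegrand _ _ _ z
    rw [hLi (hPmL hz)]
    exact H_eq_left_add_Gm c d z
  -- (2) the branch exchange: both ghost terms are the ghost representation on the common image `E`
  obtain ⟨Ψ, Ψ', hΨ0, hΨ1, hsaΨp, hsaΨm, hderivΨ, hinjΨp, hinjΨm, himageΨ, hdetΨ⟩ := exists_chartPE
  have hEs : IsSemialgebraic ℚ (Ψ '' Pp) :=
    IsSemialgebraicMapOn.isSemialgebraic_image_holds hsaΨp subset_rfl hPps
  have hposE : ∀ y ∈ Ψ '' Pp, ∀ k, 0 < aeval y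
      ((![X 1, 4 * (X 0 ^ 2 * (1 + X 0) ^ 2 + X 0 * X 1), X 0] : Fin 3 → MvPolynomial (Fin 2) ℚ) k) := by
    rintro y ⟨z, ⟨hz, -⟩, rfl⟩ k
    have hw : 0 < Ψ z 0 := by rw [hΨ0]; exact hz.1
    have hF : 0 < Ψ z 1 := by rw [hΨ1]; exact fibreCubic_pos hz.1 hz.2
    fin_cases k
    · simpa using hF
    · simp only [Fin.reduceFinMk, Matrix.cons_val_one, Matrix.cons_val_zero, map_mul, map_add, map_pow, map_one,
        map_ofNat, MvPolynomial.aeval_X]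
      positivity
    · simpa using hw
  have hpullΨp : ∀ z ∈ Pp, Gp.integrand z = KZ.mellinIntegrand (![X 1, 4 * (X 0 ^ 2 * (1 + X 0) ^ 2 + X 0 * X 1),
      X 0] : Fin 3 → MvPolynomial (Fin 2) ℚ) ![c - 1 / 2 - d, d - 1, 1] 4 (Ψ z) * |(Ψ' z).det| := by
    intro z hz
    rw [hdetΨ z, abs_of_pos hz.2]
    change KZ.mellinIntegrand _ _ _ z = _
    rw [mellin_Gp_apply, mellin_E_apply, hΨ0, hΨ1]
    exact (right_pullback_PE _ _ (z 0) (z 1) _).symm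
  have hpullΨm : ∀ z ∈ Pm, Gm.integrand z = KZ.mellinIntegrand (![X 1, 4 * (X 0 ^ 2 * (1 + X 0) ^ 2 + X 0 * X 1),
      X 0] : Fin 3 → MvPolynomial (Fin 2) ℚ) ![c - 1 / 2 - d, d - 1, 1] 4 (Ψ z) * |(Ψ' z).det| := by
    intro z hz
    rw [hdetΨ z, abs_of_neg hz.2]
    change KZ.mellinIntegrand _ _ _ z = _
    rw [mellin_Gm_apply, mellin_E_apply, hΨ0, hΨ1]
    exact (right_pullback_PE _ _ (z 0) (z 1) _).symm
  have hintE : IntegrableOn (KZ.mellinIntegrand (![X 1, 4 * (X 0 ^ 2 * (1 + X 0) ^ 2 + X 0 * X 1), X 0] :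
      Fin 3 → MvPolynomial (Fin 2) ℚ) ![c - 1 / 2 - d, d - 1, 1] 4) (Ψ '' Pp) := by
    rw [integrableOn_image_iff_integrableOn_abs_det_fderiv_smul volume hPps.measurableSet_holds
      (fun z _ => (hderivΨ z).hasFDerivWithinAt) hinjΨp]
    refine Gp.integrableOn.congr_fun (fun z hz => ?_) hPps.measurableSet_holds
    rw [hpullΨp z hz, smul_eq_mul, mul_comm]
  let Er : KZ.IntegralRep 2 := ⟨Ψ '' Pp, _, hEs, KZ.isSemialgebraicFunOn_mellinIntegrand hEs _ _ 4 hposE, hintE⟩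
  have rel₇ : of Gp - of Er ∈ relations :=
    changeOfVariablesRel_subset_relations ⟨2, Gp, Er, Ψ, Ψ', hsaΨp, fun z _ => (hderivΨ z).hasFDerivWithinAt,
      hinjΨp, rfl, fun z hz => hpullΨp z hz, rfl⟩
  have rel₈ : of Gm - of Er ∈ relations :=
    changeOfVariablesRel_subset_relations ⟨2, Gm, Er, Ψ, Ψ', hsaΨm, fun z _ => (hderivΨ z).hasFDerivWithinAt,
      hinjΨm, himageΨ, fun z hz => hpullΨm z hz, rfl⟩
  -- assembling the chain
  refine ⟨R, hbox, fun z hz => ?_, ?_⟩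
  · change KZ.mellinIntegrand _ _ _ z = _
    rw [mellin_R_apply]
    linear_combination ((z 0) ^ (2 * (c:ℝ) - 1) * (1 - z 0) ^ ((c:ℝ) + d + 1 / 2 - 1) *
      (z 1) ^ ((c:ℝ) + 1 / 2 - d - 1)) * four_mul_rpow_key (d:ℝ) hz.2.2
  · have e : of L - of R = (of L - of L₁) + (of L₁ - of LP - of LM) + (of LP - of HP - of Gp)
        - (of HM - of LM - of Gm) + (of Gp - of Er) - (of Gm - of Er) - (of H₁ - of HP - of HM)
        - (of Hr - of H₁) + (of Hr - of Mr) - (of R - of Mr) := by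
      abel
    show of L - of R ∈ relations
    rw [e]
    exact relations.sub_mem (relations.add_mem (relations.sub_mem (relations.sub_mem (relations.sub_mem
      (relations.add_mem (relations.sub_mem (relations.add_mem (relations.add_mem rel₁ rel₂) rel₅) rel₆) rel₇)
      rel₈) rel₄) rel₃) relΦ) relρ

end DdStep

open QuadStep DirichletReassoc DdStep in
/-- **Stub `stub_ddStep` — THE TWO-DUPLICATION MOVE "DD"** (an instance of the line's `stub_uniformStep`): the
Beta-product identity `B(c+½-d, 2c+2d)·B(c,d) = 4^d·B(2c, c+d+½)·B(c+½-d, d)` — Legendre's duplication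
(Andrews–Askey–Roy 1999, Thm 1.5.1) at `c+d` against Legendre's duplication at `c` — realised as a chain of moves of
the Kontsevich–Zagier calculus between the pinned representations `[(0,1)², κ x^{c-½-d}(1-x)^{2c+2d-1}y^{c-1}(1-y)^{d-1}]`
and `[(0,1)², κ4^d x^{2c-1}(1-x)^{c+d-½}y^{c-½-d}(1-y)^{d-1}]`, uniformly in the real-algebraic weight `κ` and without
cancellation: the unweighted left box as a box-Mellin member, the left chain onto the parameter surface `P`
(`DdStep.left_chain`), the right chain with its branch exchange back to the weighted right box (`DdStep.right_chain`),
scaling by `κ`, pinning (rule 1). [cite: AndrewsAskeyRoy1999, Thm 1.5.1] -/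
theorem stub_ddStep : ∀ (c d : ℚ) (κ : ℝ), 0 < c → 0 < d → d < c + 1 / 2 → IsAlgebraic ℚ κ → ∀ (r r' : Literature.NumberTheory.Transcendental.KZ.IntegralRep 2), Summit.KontsevichZagierPeriods.FermatIsogeny.BetaProductSectorDefs.IsPinned (c + 1 / 2 - d) (2 * c + 2 * d) c d κ r → Summit.KontsevichZagierPeriods.FermatIsogeny.BetaProductSectorDefs.IsPinned (2 * c) (c + d + 1 / 2) (c + 1 / 2 - d) d (κ * (4:ℝ) ^ (d:ℝ)) r' → Literature.NumberTheory.Transcendental.KZ.Equivalent r r' := by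
  intro c d κ hc hd hdc hκ r r' hr hr'
  obtain ⟨hrd, hri⟩ := hr
  obtain ⟨hr'd, hr'i⟩ := hr'
  have hA : 0 < c + 1 / 2 - d := by linarith
  have h2 : 0 < 2 * c + 2 * d := by positivity
  -- (1) the unweighted left box as a box-Mellin member
  have hint := integrableOn_betaBox (c + 1 / 2 - d) (2 * c + 2 * d) c d 1 hA h2 hc hd
  rw [show (c + 1 / 2 - d - 1 : ℚ) = c - 1 / 2 - d by ring] at hint
  obtain ⟨U, hU⟩ := (KZ.exists_isMellinMemberWith_iff _ _ _).2 hint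
  -- (2) the left chain onto the parameter surface and the right chain back to the weighted right box
  obtain ⟨L, hLd, hLi, eUL⟩ := left_chain c d U hU
  obtain ⟨R, hRd, hRi, eLR⟩ := right_chain c d hc hd hdc L hLd hLi
  -- (3) scale the unweighted chain by `κ` and pin `r`, `r'` to its ends
  have hsc : KZ.Equivalent (U.constMul κ hκ) (R.constMul κ hκ) := KZ.Equivalent.constMul κ hκ (eUL.trans eLR)
  have hrU : KZ.Equivalent r (U.constMul κ hκ) := by
    refine equivalent_constMul_of_eqOn κ hκ r U (hU.1.trans (mellinBox_betaBox.trans hrd.symm))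
      (f := fun z => (z 0) ^ (((c + 1 / 2 - d : ℚ):ℝ) - 1) * (1 - z 0) ^ (((2 * c + 2 * d : ℚ):ℝ) - 1) *
        (z 1) ^ ((c:ℝ) - 1) * (1 - z 1) ^ ((d:ℝ) - 1)) (fun z hz => ?_) (fun z hz => ?_)
    · rw [hri hz]
      simp only [mul_assoc]
    · rw [hU.2 hz, mellin_betaBox_apply]
      simp only [Matrix.cons_val_zero, Matrix.cons_val_one, Matrix.cons_val]
      push_cast
      rw [show ((c:ℝ) + 1 / 2 - d - 1) = (c:ℝ) - 1 / 2 - d by ring]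
      ring
  have hr'R : KZ.Equivalent r' (R.constMul κ hκ) := by
    refine equivalent_constMul_of_eqOn κ hκ r' R (hRd.trans hr'd.symm)
      (f := fun z => (4:ℝ) ^ (d:ℝ) * (z 0) ^ (2 * (c:ℝ) - 1) * (1 - z 0) ^ ((c:ℝ) + d + 1 / 2 - 1) *
        (z 1) ^ ((c:ℝ) + 1 / 2 - d - 1) * (1 - z 1) ^ ((d:ℝ) - 1)) (fun z hz => ?_) hRi
    rw [hr'i hz]
    push_cast
    ring
  exact hrU.trans (hsc.trans hr'R.symm)

end Summit.KontsevichZagierPeriods.FermatIsogeny.BetaProductSectorStubs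

end
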